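import Summits.CriticalPhenomena.CardyFormulaZ2.Theorems.CardyUniqueLimitCardyRigidityLoewnerKit
import Literature.Probability.RandomPlanarGeometry.LoewnerBoundaryExtension
import Literature.Probability.RandomPlanarGeometry.LoewnerRealKoebe
import Literature.Probability.RandomPlanarGeometry.CaratheodoryKernelPointwise
import HarnessLib

/-!
# Loewner–Carathéodory convergence kit, IV: the inverse maps up to the boundary off the hull

Crux `Summit.CriticalPhenomena.CardyFormulaZ2.Theses.CardyUniqueLimit.CardyRigidity`
(stmt-CriticalPhenomena-0746), line `crossing_martingale`, helper kit for the registered stub A3b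
`stub_slitObservableApprox`; sequel of `…LoewnerKit.lean` (L1/L3 for the forward maps).  The
assembly reads the `k`-th slit domain through `Φ_k ∘ f̄^{W_k}_{t_k}` on the closure of a region
`U' ⊆ ℍ` whose real boundary points lie OFF the image of the hull; here `f̄_t = Loewner.bdryInv W t`
is the boundary extension (`extendFrom ℍ`) of `f_t = g_t⁻¹ = Loewner.loewnerInv W t`.  This file
proves (L3 for the inverse maps), with Schwarz reflection replaced by the two-sided flow:

* `tendstoUniformlyOn_invFunOn_of_tendstoUniformlyOn` — complex analysis: if holomorphic `F_n → f`
  uniformly on an open `U`, `f` injective holomorphic, then about `f c` (`c ∈ U`) a disc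
  `D(f c, ρ)` is covered by `f(U)` and eventually by `F_n(U)` (the tree's covering criterion
  `CaratheodoryKernel.exists_eventually_ball_subset_image`, maximum modulus in place of Rouché),
  and the LOCAL INVERSES `invFunOn (F_n) U → invFunOn f U` converge uniformly on `D̄(f c, ρ/2)`
  (uniform continuity of the holomorphic inverse `invFunOn f U`, `Complex.differentiableOn_invFunOn_image`);
* `exists_ball_tendstoUniformlyOn_bdryInv_nhds` — for a point `z₀` ALIVE at time `t₀` under `w₀`
  (`t₀ < T_{z₀}(w₀)`; the case of interest: `z₀ = x` real, off the closure of the swallowed set,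
  `v₀ = g_{t₀}(x)` real, off the image of the hull), there is `ρ > 0` such that, as
  `(t, w) → (t₀, w₀)` in `ℝ≥0 × C([0,∞), ℝ)`, the boundary extensions `f̄^{w}_t` converge to
  `f̄^{w₀}_{t₀}` UNIFORMLY ON THE CLOSED HALF-DISC `D̄(v₀, ρ) ∩ {im ≥ 0}` (up to the real axis),
  `f̄^{w₀}_{t₀}` is continuous there with `f̄^{w₀}_{t₀}(v₀) = z₀`, and all these `f̄` are, on that
  half-disc, restrictions of local holomorphic inverses of the (two-sided) Loewner maps
  (`g^{w}_t → g^{w₀}_{t₀}` uniformly on a disc about `z₀`, kit I; the preimage of a point of `ℍ`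
  under the two-sided map lies in `ℍ` by the conjugation symmetry `Loewner.map_conj`, so the local
  inverse IS `f_t` on the upper half-disc, and its continuity gives the boundary values).

References: Lawler (2005) §4.1, §4.7; Pommerenke (1992) Thm. 1.8 (proof (a)), Cor. 2.4;
Conway (1978) IV.7.6; Kemppainen–Smirnov (2017) App. A Lemma 5.4.
-/

noncomputable section

open Set Filter Topology Metric Function
open scoped NNReal
open UpperHalfPlane (upperHalfPlaneSet)
open Literature.Probability.RandomPlanarGeometry Literature.Probability.RandomPlanarGeometry.Loewner

namespace Summit.CriticalPhenomena.CardyFormulaZ2.Cruxes.CardyRigidity.CrossingMartingale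

namespace LoewnerKit

/-! ### Complex analysis: local inverses of uniformly convergent holomorphic maps -/

section LocalInverse

variable {ι : Type*} {l : Filter ι} {F : ι → ℂ → ℂ} {f : ℂ → ℂ} {U : Set ℂ}

/-- **Uniform convergence of local inverses.**  Let `U` be open, `f` holomorphic and injective on
`U`, `F_n` eventually holomorphic on `U` with `F_n → f` uniformly on `U`, and `c ∈ U`.  Then there
is `ρ > 0` with `D(f c, ρ) ⊆ f(U)`, eventually `D(f c, ρ) ⊆ F_n(U)`, and the local inverses
converge: `invFunOn (F_n) U → invFunOn f U` uniformly on `D̄(f c, ρ/2)`.  (Covering criterion for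
`ρ`; then for `v` in the half disc, `z_n = F_n⁻¹(v) ∈ U` has `f(z_n)` within `sup_U |F_n - f|` of
`v`, and `f⁻¹` is uniformly continuous on `D̄(f c, 3ρ/4)`.)
[cite: PommerenkeBBCM1992, Thm. 1.8 (proof, part (a))] [cite: Conway1978, Ch. IV Cor. 7.6] -/
theorem tendstoUniformlyOn_invFunOn_of_tendstoUniformlyOn (hU : IsOpen U)
    (hF : ∀ᶠ n in l, DifferentiableOn ℂ (F n) U) (hf : DifferentiableOn ℂ f U) (hinj : InjOn f U)
    (hlim : TendstoUniformlyOn F f l U) {c : ℂ} (hc : c ∈ U) :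
    ∃ ρ > (0 : ℝ), ball (f c) ρ ⊆ f '' U ∧ (∀ᶠ n in l, ball (f c) ρ ⊆ F n '' U) ∧
      TendstoUniformlyOn (fun n ↦ invFunOn (F n) U) (invFunOn f U) l (closedBall (f c) (ρ / 2)) := by
  have hloc : TendstoLocallyUniformlyOn F f l U := hlim.tendstoLocallyUniformlyOn
  obtain ⟨ρ, hρ, hcov⟩ := CaratheodoryKernel.exists_eventually_ball_subset_image hU hF
    hf.continuousOn hinj hloc hc
  -- a disc about `f c` inside the open set `f(U)`
  have hderiv : ∀ z ∈ U, deriv f z ≠ 0 := fun z hz ↦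
    Literature.Analysis.Complex.SCV.deriv_ne_zero_of_injOn hf hU hinj hz
  obtain ⟨ρ₀, hρ₀, hcovf⟩ := Metric.isOpen_iff.1 (Complex.isOpen_image_of_deriv_ne_zero hU hf hderiv)
    (f c) ⟨c, hc, rfl⟩
  -- shrink to a common radius
  set ρ₁ : ℝ := min ρ ρ₀ with hρ₁
  have hρ₁pos : 0 < ρ₁ := lt_min hρ hρ₀
  have hcov₁ : ∀ᶠ n in l, ball (f c) ρ₁ ⊆ F n '' U :=
    hcov.mono fun n hn ↦ (ball_subset_ball (min_le_left _ _)).trans hn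
  have hcovf₁ : ball (f c) ρ₁ ⊆ f '' U := (ball_subset_ball (min_le_right _ _)).trans hcovf
  refine ⟨ρ₁, hρ₁pos, hcovf₁, hcov₁, ?_⟩
  -- the inverse `h = f⁻¹` is continuous on `f(U)`, uniformly on the compact `D̄(f c, 3ρ₁/4)`
  set h := invFunOn f U with hh
  have hcont : ContinuousOn h (f '' U) :=
    (Complex.differentiableOn_invFunOn_image hU hf hinj hderiv).continuousOn
  have hK : IsCompact (closedBall (f c) (3 * ρ₁ / 4)) := isCompact_closedBall _ _
  have hKsub : closedBall (f c) (3 * ρ₁ / 4) ⊆ f '' U :=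
    (closedBall_subset_ball (by linarith)).trans hcovf₁
  have huc := hK.uniformContinuousOn_of_continuous (hcont.mono hKsub)
  rw [Metric.tendstoUniformlyOn_iff]
  intro ε hε
  obtain ⟨δ, hδ, hδε⟩ := Metric.uniformContinuousOn_iff.1 huc ε hε
  have hη : 0 < min δ (ρ₁ / 4) := lt_min hδ (by positivity)
  filter_upwards [hcov₁, (Metric.tendstoUniformlyOn_iff.1 hlim) _ hη] with n hn hn'
  intro v hv
  have hvball : v ∈ ball (f c) ρ₁ := closedBall_subset_ball (by linarith) hv
  -- `z_n = F_n⁻¹ v ∈ U`, `F_n z_n = v`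
  obtain ⟨a, haU, hav⟩ := hn hvball
  have hex : ∃ a ∈ U, F n a = v := ⟨a, haU, hav⟩
  have hzU : invFunOn (F n) U v ∈ U := invFunOn_mem hex
  have hzv : F n (invFunOn (F n) U v) = v := invFunOn_eq hex
  -- `u = f z_n` is close to `v`, and `h u = z_n`
  have huv : dist (f (invFunOn (F n) U v)) v < min δ (ρ₁ / 4) := by
    have := hn' _ hzU
    rwa [hzv] at this
  have hhu : h (f (invFunOn (F n) U v)) = invFunOn (F n) U v := hinj.leftInvOn_invFunOn hzU
  have huK : f (invFunOn (F n) U v) ∈ closedBall (f c) (3 * ρ₁ / 4) := by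
    rw [mem_closedBall]
    have h1 : dist (f (invFunOn (F n) U v)) (f c) ≤
        dist (f (invFunOn (F n) U v)) v + dist v (f c) := dist_triangle _ _ _
    have h2 : dist v (f c) ≤ ρ₁ / 2 := hv
    have h3 : dist (f (invFunOn (F n) U v)) v < ρ₁ / 4 := huv.trans_le (min_le_right _ _)
    linarith
  have hvK : v ∈ closedBall (f c) (3 * ρ₁ / 4) := closedBall_subset_closedBall (by linarith) hv
  rw [← hhu, dist_comm]
  exact hδε _ huK v hvK (huv.trans_le (min_le_left _ _))

end LocalInverse

/-! ### The two-sided Loewner map near an alive point: local inverse, `f_t` and `f̄_t` -/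

section Boundary

variable {W : ℝ≥0 → ℝ}

/-- **Preimages of upper-half-plane points under the two-sided Loewner map lie in `ℍ`**: for an
alive point `z` (`t < T_z`), `im g_t(z) > 0` forces `im z > 0` — real alive points have real
images (`Loewner.map_ofReal_im`) and conjugates of points of `H_t` are mapped into the lower
half-plane (`Loewner.map_im_neg_of_conj_mem`, conjugation symmetry of the flow).
[cite: Lawler2005, Ch. 4 §4.1] -/
theorem im_pos_of_im_map_pos (hW : Continuous W) {t : ℝ≥0} {z : ℂ}
    (hz : (t : WithTop ℝ≥0) < swallowingTime W z) (h : 0 < (map W t z).im) : 0 < z.im := by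
  rcases lt_trichotomy z.im 0 with hneg | h0 | hpos
  · have hcz : (starRingEnd ℂ) z ∈ domain W t := by
      rw [mem_domain_iff]
      refine ⟨?_, by rw [swallowingTime_conj]; exact hz⟩
      show 0 < ((starRingEnd ℂ) z).im
      rw [Complex.conj_im]
      linarith
    have := map_im_neg_of_conj_mem hW hcz
    linarith
  · have hzre : z = ((z.re : ℝ) : ℂ) := Complex.ext (by simp) (by simp [h0])
    have hz' : (t : WithTop ℝ≥0) < swallowingTime W ((z.re : ℝ) : ℂ) := by rwa [← hzre]
    have := map_ofReal_im hW hz'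
    rw [← hzre] at this
    linarith
  · exact hpos

/-- An alive point of the closed upper half-plane is mapped into the closed upper half-plane.
[cite: Lawler2005, Ch. 4 §4.1] -/
theorem im_map_nonneg (hW : Continuous W) {t : ℝ≥0} {z : ℂ}
    (hz : (t : WithTop ℝ≥0) < swallowingTime W z) (h : 0 ≤ z.im) : 0 ≤ (map W t z).im := by
  rcases h.lt_or_eq with hpos | h0
  · exact (mapsTo_map hW t ((mem_domain_iff W t z).2 ⟨hpos, hz⟩)).le
  · have hzre : z = ((z.re : ℝ) : ℂ) := Complex.ext (by simp) (by simp [← h0])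
    have hz' : (t : WithTop ℝ≥0) < swallowingTime W ((z.re : ℝ) : ℂ) := by rwa [← hzre]
    have := map_ofReal_im hW hz'
    rw [← hzre] at this
    exact this.symm.le

/-- **The local inverse of the two-sided Loewner map on an alive open set**: `g_t` is holomorphic
and injective there with open image, and `invFunOn (g_t) U` is holomorphic (hence continuous) on
`g_t(U)` (`Complex.differentiableOn_invFunOn_image`). [cite: Conway1978, Ch. IV Cor. 7.6] -/
theorem continuousOn_invFunOn_map (hW : Continuous W) {t : ℝ≥0} {U : Set ℂ} (hUo : IsOpen U)
    (hU : ∀ z ∈ U, (t : WithTop ℝ≥0) < swallowingTime W z) :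
    IsOpen (map W t '' U) ∧ ContinuousOn (invFunOn (map W t) U) (map W t '' U) := by
  have hdiff : DifferentiableOn ℂ (map W t) U :=
    (differentiableOn_map_of_lt_swallowingTime hW t).mono hU
  have hinj : InjOn (map W t) U := (injOn_map_of_lt_swallowingTime hW t).mono hU
  have hderiv : ∀ z ∈ U, deriv (map W t) z ≠ 0 := fun z hz ↦
    Literature.Analysis.Complex.SCV.deriv_ne_zero_of_injOn hdiff hUo hinj hz
  exact ⟨Complex.isOpen_image_of_deriv_ne_zero hUo hdiff hderiv,
    (Complex.differentiableOn_invFunOn_image hUo hdiff hinj hderiv).continuousOn⟩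

/-- **On `ℍ` the local inverse is `f_t`**: for a point `v ∈ ℍ` of the image `g_t(U)` of an alive
set `U`, `f_t(v) = invFunOn (g_t) U v` (both are alive preimages of `v`; `g_t` is injective on the
alive set, `Loewner.injOn_map_of_lt_swallowingTime`). [cite: Lawler2005, Ch. 4 §4.1] -/
theorem loewnerInv_eq_invFunOn (hW : Continuous W) {t : ℝ≥0} {U : Set ℂ}
    (hU : ∀ z ∈ U, (t : WithTop ℝ≥0) < swallowingTime W z) {v : ℂ} (hv : 0 < v.im)
    (hvU : v ∈ map W t '' U) : loewnerInv W t v = invFunOn (map W t) U v := by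
  have hex : ∃ a ∈ U, map W t a = v := hvU
  have hzU : invFunOn (map W t) U v ∈ U := invFunOn_mem hex
  have hzv : map W t (invFunOn (map W t) U v) = v := invFunOn_eq hex
  have h1 : (t : WithTop ℝ≥0) < swallowingTime W (loewnerInv W t v) :=
    ((mem_domain_iff W t _).1 (loewnerInv_mem_domain hW t hv)).2
  refine injOn_map_of_lt_swallowingTime hW t h1 (hU _ hzU) ?_
  rw [map_loewnerInv hW t hv, hzv]

/-- **On the closed upper part of a covered disc the boundary extension `f̄_t` is the local
inverse**: if the disc `D(v₀, ρ)` lies in the image `g_t(U)` of an alive open set `U`, then for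
`v ∈ D(v₀, ρ)` with `im v ≥ 0`, `f̄_t(v) = invFunOn (g_t) U v` (the local inverse is continuous at
`v` and agrees with `f_t` on `D(v₀, ρ) ∩ ℍ`, so it is THE limit of `f_t` within `ℍ` at `v`).
[cite: Lawler2005, Rem. 4.32] -/
theorem bdryInv_eq_invFunOn (hW : Continuous W) {t : ℝ≥0} {U : Set ℂ} (hUo : IsOpen U)
    (hU : ∀ z ∈ U, (t : WithTop ℝ≥0) < swallowingTime W z) {v₀ : ℂ} {ρ : ℝ}
    (hcov : ball v₀ ρ ⊆ map W t '' U) {v : ℂ} (hv : v ∈ ball v₀ ρ) (hvim : 0 ≤ v.im) :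
    bdryInv W t v = invFunOn (map W t) U v := by
  obtain ⟨hopen, hcont⟩ := continuousOn_invFunOn_map hW hUo hU
  have hcv : ContinuousAt (invFunOn (map W t) U) v := hcont.continuousAt (hopen.mem_nhds (hcov hv))
  have heq : ∀ᶠ w in 𝓝[upperHalfPlaneSet] v, invFunOn (map W t) U w = loewnerInv W t w := by
    filter_upwards [inter_mem_nhdsWithin upperHalfPlaneSet (isOpen_ball.mem_nhds hv)] with w hw
    exact (loewnerInv_eq_invFunOn hW hU hw.1 (hcov hw.2)).symm
  have hlim : Tendsto (loewnerInv W t) (𝓝[upperHalfPlaneSet] v) (𝓝 (invFunOn (map W t) U v)) :=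
    (hcv.tendsto.mono_left nhdsWithin_le_nhds).congr' heq
  exact extendFrom_eq (mem_closure_upperHalfPlaneSet_iff.2 hvim) hlim

/-- **(L3, inverse maps) Convergence of the boundary extensions `f̄^{w}_t` up to the real axis,
off the hull.**  Let `z₀` (with `im z₀ ≥ 0`; the case of interest is `z₀ = x` real, off the closure
of the set swallowed by time `t₀`) be alive at time `t₀` under `w₀`, and `v₀ = g^{w₀}_{t₀}(z₀)`.  Then
there is `ρ > 0` such that: `f̄^{w₀}_{t₀}(v₀) = z₀`; `f̄^{w₀}_{t₀}` is continuous on the closed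
half-disc `D̄(v₀, ρ) ∩ {im ≥ 0}`; and, as `(t, w) → (t₀, w₀)` in `ℝ≥0 × C([0,∞), ℝ)`,
`f̄^{w}_t → f̄^{w₀}_{t₀}` UNIFORMLY on that closed half-disc.  (Kit I gives `g^{w}_t → g^{w₀}_{t₀}`
uniformly on an alive disc `D̄(z₀, r)`; the local inverses converge uniformly about `v₀`
(`tendstoUniformlyOn_invFunOn_of_tendstoUniformlyOn`) and ARE the `f̄` there
(`bdryInv_eq_invFunOn`).) [cite: PommerenkeBBCM1992, Cor. 2.4] [cite: Lawler2005, §4.7 Prop. 4.47] -/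
theorem exists_ball_tendstoUniformlyOn_bdryInv_nhds (q₀ : ℝ≥0 × C(ℝ≥0, ℝ)) {z₀ : ℂ}
    (hz₀ : (q₀.1 : WithTop ℝ≥0) < swallowingTime q₀.2 z₀) (hz₀' : 0 ≤ z₀.im) :
    ∃ ρ > (0 : ℝ),
      bdryInv q₀.2 q₀.1 (map q₀.2 q₀.1 z₀) = z₀ ∧
      ContinuousOn (bdryInv q₀.2 q₀.1) (closedBall (map q₀.2 q₀.1 z₀) ρ ∩ {v : ℂ | 0 ≤ v.im}) ∧
      TendstoUniformlyOn (fun (q : ℝ≥0 × C(ℝ≥0, ℝ)) (v : ℂ) ↦ bdryInv q.2 q.1 v)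
        (bdryInv q₀.2 q₀.1) (𝓝 q₀) (closedBall (map q₀.2 q₀.1 z₀) ρ ∩ {v : ℂ | 0 ≤ v.im}) := by
  obtain ⟨t₀, w₀⟩ := q₀
  simp only at hz₀ ⊢
  -- an alive disc about `z₀` on which the two-sided maps converge (kit I)
  obtain ⟨r, hr, halive₀, halive, hconv⟩ := exists_closedBall_tendstoUniformlyOn_map_nhds (t₀, w₀) hz₀
  have hUo : IsOpen (ball z₀ r) := isOpen_ball
  have hU₀ : ∀ z ∈ ball z₀ r, (t₀ : WithTop ℝ≥0) < swallowingTime w₀ z := fun z hz ↦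
    halive₀ z (ball_subset_closedBall hz)
  have hUq : ∀ᶠ q : ℝ≥0 × C(ℝ≥0, ℝ) in 𝓝 (t₀, w₀), ∀ z ∈ ball z₀ r,
      (q.1 : WithTop ℝ≥0) < swallowingTime q.2 z :=
    halive.mono fun q hq z hz ↦ hq z (ball_subset_closedBall hz)
  have hF : ∀ᶠ q : ℝ≥0 × C(ℝ≥0, ℝ) in 𝓝 (t₀, w₀), DifferentiableOn ℂ (map q.2 q.1) (ball z₀ r) :=
    hUq.mono fun q hq ↦ (differentiableOn_map_of_lt_swallowingTime q.2.continuous q.1).mono hq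
  have hf : DifferentiableOn ℂ (map w₀ t₀) (ball z₀ r) :=
    (differentiableOn_map_of_lt_swallowingTime w₀.continuous t₀).mono hU₀
  have hinj : InjOn (map w₀ t₀) (ball z₀ r) := (injOn_map_of_lt_swallowingTime w₀.continuous t₀).mono hU₀
  have hlim : TendstoUniformlyOn (fun (q : ℝ≥0 × C(ℝ≥0, ℝ)) (z : ℂ) ↦ map q.2 q.1 z) (map w₀ t₀)
      (𝓝 (t₀, w₀)) (ball z₀ r) := hconv.mono ball_subset_closedBall
  obtain ⟨ρ, hρ, hcov₀, hcov, hinvlim⟩ :=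
    tendstoUniformlyOn_invFunOn_of_tendstoUniformlyOn hUo hF hf hinj hlim (mem_ball_self hr)
  have hhalf : closedBall (map w₀ t₀ z₀) (ρ / 2) ⊆ ball (map w₀ t₀ z₀) ρ :=
    closedBall_subset_ball (half_lt_self hρ)
  refine ⟨ρ / 2, half_pos hρ, ?_, ?_, ?_⟩
  · rw [bdryInv_eq_invFunOn w₀.continuous hUo hU₀ hcov₀ (mem_ball_self hρ)
      (im_map_nonneg w₀.continuous hz₀ hz₀')]
    exact hinj.leftInvOn_invFunOn (mem_ball_self hr)
  · obtain ⟨-, hcont⟩ := continuousOn_invFunOn_map w₀.continuous hUo hU₀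
    refine (hcont.mono fun v hv ↦ hcov₀ (hhalf hv.1)).congr fun v hv ↦ ?_
    exact bdryInv_eq_invFunOn w₀.continuous hUo hU₀ hcov₀ (hhalf hv.1) hv.2
  · rw [Metric.tendstoUniformlyOn_iff] at hinvlim ⊢
    intro ε hε
    filter_upwards [hinvlim ε hε, hcov, hUq] with q hq hqcov hqU v hv
    rw [bdryInv_eq_invFunOn w₀.continuous hUo hU₀ hcov₀ (hhalf hv.1) hv.2,
      bdryInv_eq_invFunOn q.2.continuous hUo hqU hqcov (hhalf hv.1) hv.2]
    exact hq v hv.1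

/-- **(L3, inverse maps on `ℍ` up to the boundary)**: under the same hypotheses, on the open upper
part `D̄(v₀, ρ) ∩ ℍ` of the half-disc the inverse maps themselves converge uniformly,
`f^{w}_t → f^{w₀}_{t₀}` (`f̄ = f` on `ℍ`, `Loewner.bdryInv_eq_of_mem`) — uniformly up to the real
axis, complementing kit I's convergence on `{im ≥ y}`. [cite: PommerenkeBBCM1992, Cor. 2.4] -/
theorem exists_ball_tendstoUniformlyOn_loewnerInv_nhds (q₀ : ℝ≥0 × C(ℝ≥0, ℝ)) {z₀ : ℂ}
    (hz₀ : (q₀.1 : WithTop ℝ≥0) < swallowingTime q₀.2 z₀) (hz₀' : 0 ≤ z₀.im) :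
    ∃ ρ > (0 : ℝ),
      TendstoUniformlyOn (fun (q : ℝ≥0 × C(ℝ≥0, ℝ)) (v : ℂ) ↦ loewnerInv q.2 q.1 v)
        (loewnerInv q₀.2 q₀.1) (𝓝 q₀) (closedBall (map q₀.2 q₀.1 z₀) ρ ∩ upperHalfPlaneSet) := by
  obtain ⟨ρ, hρ, -, -, hlim⟩ := exists_ball_tendstoUniformlyOn_bdryInv_nhds q₀ hz₀ hz₀'
  refine ⟨ρ, hρ, ?_⟩
  rw [Metric.tendstoUniformlyOn_iff] at hlim ⊢
  intro ε hε
  filter_upwards [hlim ε hε] with q hq v hv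
  have h := hq v ⟨hv.1, show 0 ≤ v.im from le_of_lt hv.2⟩
  rwa [bdryInv_eq_of_mem q₀.2.continuous q₀.1 hv.2, bdryInv_eq_of_mem q.2.continuous q.1 hv.2] at h

end Boundary

end LoewnerKit

/-- **Registered form** (anchor `loewnerKit_tendstoUniformlyOn_bdryInv_nhds` of stmt-CriticalPhenomena-0746): about the
image `v₀ = g^{w₀}_{t₀}(z₀)` of an alive point `z₀` of the closed upper half-plane, the boundary extensions `f̄^{w}_t` of
the inverse Loewner maps converge to `f̄^{w₀}_{t₀}` uniformly on a closed half-disc `D̄(v₀, ρ) ∩ {im ≥ 0}` as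
`(t, w) → (t₀, w₀)`, with `f̄^{w₀}_{t₀}(v₀) = z₀` and `f̄^{w₀}_{t₀}` continuous there. [cite: PommerenkeBBCM1992, Cor. 2.4] -/
theorem loewnerKit_tendstoUniformlyOn_bdryInv_nhds : ∀ (q₀ : NNReal × ContinuousMap NNReal ℝ) {z₀ : ℂ}, (q₀.1 : WithTop NNReal) < Literature.Probability.RandomPlanarGeometry.Loewner.swallowingTime (⇑q₀.2) z₀ → 0 ≤ z₀.im → ∃ ρ > (0 : ℝ), Literature.Probability.RandomPlanarGeometry.Loewner.bdryInv (⇑q₀.2) q₀.1 (Literature.Probability.RandomPlanarGeometry.Loewner.map (⇑q₀.2) q₀.1 z₀) = z₀ ∧ ContinuousOn (Literature.Probability.RandomPlanarGeometry.Loewner.bdryInv (⇑q₀.2) q₀.1) (Metric.closedBall (Literature.Probability.RandomPlanarGeometry.Loewner.map (⇑q₀.2) q₀.1 z₀) ρ ∩ {v : ℂ | 0 ≤ v.im}) ∧ TendstoUniformlyOn (fun (q : NNReal × ContinuousMap NNReal ℝ) (v : ℂ) ↦ Literature.Probability.RandomPlanarGeometry.Loewner.bdryInv (⇑q.2) q.1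 v) (Literature.Probability.RandomPlanarGeometry.Loewner.bdryInv (⇑q₀.2) q₀.1) (nhds q₀) (Metric.closedBall (Literature.Probability.RandomPlanarGeometry.Loewner.map (⇑q₀.2) q₀.1 z₀) ρ ∩ {v : ℂ | 0 ≤ v.im}) :=
  fun q₀ _ hz₀ hz₀' ↦ LoewnerKit.exists_ball_tendstoUniformlyOn_bdryInv_nhds q₀ hz₀ hz₀'

end Summit.CriticalPhenomena.CardyFormulaZ2.Cruxes.CardyRigidity.CrossingMartingale

end
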